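import Mathlib.Topology.Covering.Basic
import Mathlib.Topology.CompactOpen
import Mathlib.Topology.Connected.LocallyConnected
import Mathlib.Topology.Connected.LocallyPathConnected
import Mathlib.Topology.Separation.Hausdorff
import HarnessLib

/-!
# Extension of continuous sections of a covering map (Cerf 1968, Ch. I §4, Lemmes 5 and 6)

Topic `Literature/Topology/CoveringSpaces` (moved 2026-08-16 from the depth-2 path
`Literature/Topology/CoveringSectionExtension.lean`, which is now a deprecated-alias shim). J. Cerf, *Sur les difféomorphismes de la sphère de dimension trois
(Γ₄ = 0)*, LNM 53 (1968), Ch. I §4 "Généralités sur le prolongement des sections d'un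
revêtement", the two lemmas through which the main theorem (Théorème 1″: the covering `ℛ` of the
space of `2`-spheres of `ℝ³` has a continuous section) is reduced to the construction of a section
over a convenient dense part (`(ℱ/𝒦)⁰ ∪ (ℱ/𝒦)¹`, Ch. II):

> **Définition.** `ℬ ⊆ 𝒜` is *locally arc-connected in `𝒜`* at `x ∈ 𝒜` if every neighbourhood
> `𝒰` of `x` contains a neighbourhood `𝒱` of `x` such that any two points of `𝒱 ∩ ℬ` are joined
> by a path in `𝒰 ∩ ℬ`.
> **Lemme 5.** *Let `𝒜` be locally connected and `ℬ ⊆ 𝒜` locally arc-connected in `𝒜`. If `ℛ` is a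
> covering of `𝒜`, every continuous section of `ℛ` over `ℬ` extends to a continuous section over
> the closure `ℬ̄`.*
> **Lemme 6.** *Let `𝒜` be locally arc-connected, `ℬ ⊆ 𝒜` open and dense, and suppose the paths of
> `ℬ` are dense in the paths of `𝒜` (uniform convergence). If `ℛ` is a covering of `𝒜`, every
> continuous section of `ℛ` over `ℬ` extends to a continuous section over `𝒜`.*

* `exists_section_extension_closure` — Lemme 5 (the local arc-connectedness is required at the
  points of `ℬ̄` only, which is all the proof uses; the total space is assumed Hausdorff, as are
  all of Cerf's function spaces, so that the local extensions through the sheets glue);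
* `locallyJoined_of_dense_paths` — the reduction in the proof of Lemme 6: under its hypotheses
  (density of paths for the compact-open topology on `C([0, 1], 𝒜)`, which is the topology of
  uniform convergence when `𝒜` is metrisable) `ℬ` is locally arc-connected in `𝒜` at every
  point;
* `exists_section_extension_of_dense_paths` — Lemme 6.

Everything here is proved; there are no definitions and no named facts.

## References

* J. Cerf, *Sur les difféomorphismes de la sphère de dimension trois (Γ₄ = 0)*, Lecture Notes in
  Mathematics 53, Springer (1968), Ch. I §4, Lemmes 5, 6. [CerfDiffeoSphere1968]
-/

open Set Filter Topology Function

namespace Literature.Topology.CoveringSpaces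

universe u v

variable {A : Type u} {R : Type v} [TopologicalSpace A] [TopologicalSpace R]

/-! ### Lemme 5: extension over the closure -/

/-- **Local extension through one sheet** (the core of Cerf's Lemme 5). With the hypotheses of
`exists_section_extension_closure`, near every point `x` of `ℬ̄` there is a continuous local
section of the covering over an open neighbourhood `V` of `x` which agrees with `σ` on `V ∩ ℬ`:
the section `σ` maps `𝒱 ∩ ℬ` into a single sheet over an evenly covered connected `𝒰`, because
two of its values are joined by the lift `σ ∘ γ` of a path `γ` in `𝒰 ∩ ℬ`, on which the (discrete)
sheet index is constant. [cite: CerfDiffeoSphere1968, Ch. I §4, Lemme 5] -/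
theorem exists_local_section_extension {p : R → A} (hp : IsCoveringMap p) [LocallyConnectedSpace A]
    {B : Set A}
    (hB : ∀ x ∈ closure B, ∀ U ∈ 𝓝 x, ∃ V ∈ 𝓝 x, V ⊆ U ∧ ∀ b ∈ V ∩ B, ∀ b' ∈ V ∩ B, JoinedIn (U ∩ B) b b')
    {σ : A → R} (hσ : ContinuousOn σ B) (hpσ : ∀ b ∈ B, p (σ b) = b) {x : A} (hx : x ∈ closure B) :
    ∃ V ∈ 𝓝 x, IsOpen V ∧ ∃ τ : A → R, ContinuousOn τ V ∧ (∀ y ∈ V, p (τ y) = y) ∧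
      ∀ b ∈ V ∩ B, τ b = σ b := by
  classical
  -- an evenly covered open neighbourhood `U₀` of `x`, with its trivialisation `H`
  obtain ⟨hdisc, U₀, hxU₀, hU₀o, -, H, hH⟩ := hp x
  -- a connected open `U ∋ x` inside `U₀`, and `V ∋ x` open inside `U` with the path property
  obtain ⟨U, hUsub, hUo, hxU, hUconn⟩ :=
    (locallyConnectedSpace_iff_subsets_isOpen_isConnected.1 ‹_›) x U₀ (hU₀o.mem_nhds hxU₀)
  obtain ⟨V₁, hV₁, hV₁U, hV₁path⟩ := hB x hx U (hUo.mem_nhds hxU)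
  set V : Set A := interior V₁ with hV
  have hVo : IsOpen V := isOpen_interior
  have hxV : x ∈ V := mem_interior_iff_mem_nhds.2 hV₁
  have hVU₀ : V ⊆ U₀ := (interior_subset.trans hV₁U).trans hUsub
  -- `σ` maps `V ∩ B` over `U₀`
  have hσU₀ : ∀ b ∈ V ∩ B, p (σ b) ∈ U₀ := fun b hb => by
    rw [hpσ b hb.2]; exact hVU₀ hb.1
  -- along `σ ∘ γ`, `γ` a path in `U ∩ B`, the (discrete) sheet index is constant
  have hidx : ∀ b (hb : b ∈ V ∩ B) b' (hb' : b' ∈ V ∩ B),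
      (H ⟨σ b, hσU₀ b hb⟩).2 = (H ⟨σ b', hσU₀ b' hb'⟩).2 := by
    intro b hb b' hb'
    obtain ⟨γ, hγ⟩ : ∃ γ : Path b b', ∀ t, γ t ∈ U ∩ B := by
      have hj := hV₁path b ⟨interior_subset hb.1, hb.2⟩ b' ⟨interior_subset hb'.1, hb'.2⟩
      exact ⟨hj.somePath, hj.somePath_mem⟩
    have hmem : ∀ t, p (σ (γ t)) ∈ U₀ := fun t => by
      rw [hpσ _ (hγ t).2]; exact hUsub (hγ t).1
    -- the lifted path, as a continuous map into `p ⁻¹' U₀`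
    have hcont : Continuous fun t : unitInterval => (⟨σ (γ t), hmem t⟩ : ↥(p ⁻¹' U₀)) := by
      refine Continuous.subtype_mk ?_ _
      exact hσ.comp_continuous γ.continuous fun t => (hγ t).2
    have hconst := PreconnectedSpace.constant (Y := ↥(p ⁻¹' {x})) inferInstance
      ((continuous_snd.comp H.continuous).comp hcont) (x := 0) (y := 1)
    simp only [Function.comp_apply, Path.source, Path.target] at hconst
    exact hconst
  -- a point of `V ∩ B` (as `x ∈ B̄`) and its sheet index `i₀`
  obtain ⟨b₀, hb₀⟩ : (V ∩ B).Nonempty := mem_closure_iff_nhds.1 hx V (hVo.mem_nhds hxV)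
  set i₀ : ↥(p ⁻¹' {x}) := (H ⟨σ b₀, hσU₀ b₀ hb₀⟩).2 with hi₀
  -- the local section through the sheet `i₀`
  set τ : A → R := fun y => if h : y ∈ U₀ then ((H.symm (⟨y, h⟩, i₀) : ↥(p ⁻¹' U₀)) : R) else σ y with hτ
  have hτU₀ : ∀ y (hy : y ∈ U₀), τ y = ((H.symm (⟨y, hy⟩, i₀) : ↥(p ⁻¹' U₀)) : R) := fun y hy => by
    simp only [hτ, dif_pos hy]
  have hpτ : ∀ y ∈ U₀, p (τ y) = y := by
    intro y hy
    rw [hτU₀ y hy]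
    have h1 := hH (H.symm (⟨y, hy⟩, i₀))
    rw [H.apply_symm_apply] at h1
    exact h1.symm
  have hτcont : ContinuousOn τ U₀ := by
    rw [continuousOn_iff_continuous_restrict]
    have h1 : Continuous fun y : ↥U₀ => ((H.symm (y, i₀) : ↥(p ⁻¹' U₀)) : R) :=
      continuous_subtype_val.comp (H.symm.continuous.comp (continuous_id.prodMk continuous_const))
    refine h1.congr fun y => ?_
    simp only [restrict_apply, hτ, dif_pos y.2]
  have hτσ : ∀ b ∈ V ∩ B, τ b = σ b := by
    intro b hb
    have hbU₀ : b ∈ U₀ := hVU₀ hb.1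
    have hσb : p (σ b) ∈ U₀ := hσU₀ b hb
    rw [hτU₀ b hbU₀]
    -- `H (σ b) = (b, idx (σ b)) = (b, i₀)`
    have h1 : H ⟨σ b, hσb⟩ = (⟨b, hbU₀⟩, i₀) := by
      refine Prod.ext ?_ ?_
      · apply Subtype.ext
        have := hH ⟨σ b, hσb⟩
        simp only at this
        rw [this, hpσ b hb.2]
      · rw [hi₀]
        exact hidx b hb b₀ hb₀
    have h2 : H.symm (⟨b, hbU₀⟩, i₀) = ⟨σ b, hσb⟩ := by
      rw [← h1, H.symm_apply_apply]
    rw [h2]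
  exact ⟨V, hVo.mem_nhds hxV, hVo, τ, hτcont.mono hVU₀, fun y hy => hpτ y (hVU₀ hy), hτσ⟩

/-- **Cerf's Lemme 5: a continuous section of a covering over `ℬ` extends continuously over the
closure `ℬ̄`**, provided the base is locally connected and `ℬ` is locally arc-connected in the base
at the points of `ℬ̄` (any two points of `𝒱 ∩ ℬ` are joined inside `𝒰 ∩ ℬ`); the total space is
Hausdorff. The local extensions of `exists_local_section_extension` agree where they overlap —
two continuous maps which coincide on `ℬ` coincide on its closure — and glue.
[cite: CerfDiffeoSphere1968, Ch. I §4, Lemme 5] -/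
theorem exists_section_extension_closure [T2Space R] {p : R → A} (hp : IsCoveringMap p)
    [LocallyConnectedSpace A] {B : Set A}
    (hB : ∀ x ∈ closure B, ∀ U ∈ 𝓝 x, ∃ V ∈ 𝓝 x, V ⊆ U ∧ ∀ b ∈ V ∩ B, ∀ b' ∈ V ∩ B, JoinedIn (U ∩ B) b b')
    {σ : A → R} (hσ : ContinuousOn σ B) (hpσ : ∀ b ∈ B, p (σ b) = b) :
    ∃ τ : A → R, ContinuousOn τ (closure B) ∧ (∀ y ∈ closure B, p (τ y) = y) ∧ ∀ b ∈ B, τ b = σ b := by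
  classical
  -- choose local extensions at the points of the closure
  have key := fun x (hx : x ∈ closure B) => exists_local_section_extension hp hB hσ hpσ hx
  choose V hVn hVo τ hτc hpτ hτσ using key
  -- two local extensions agree at a common point of the closure
  have hagree : ∀ x (hx : x ∈ closure B) x' (hx' : x' ∈ closure B) y, y ∈ closure B → y ∈ V x hx → y ∈ V x' hx' →
      τ x hx y = τ x' hx' y := by
    intro x hx x' hx' y hy hyV hyV'
    set W : Set A := V x hx ∩ V x' hx' with hW
    have hWo : IsOpen W := (hVo x hx).inter (hVo x' hx')
    have hyW : y ∈ W := ⟨hyV, hyV'⟩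
    have hyc : y ∈ closure (W ∩ B) := hWo.inter_closure ⟨hyW, hy⟩
    haveI : NeBot (𝓝[W ∩ B] y) := mem_closure_iff_nhdsWithin_neBot.1 hyc
    have h1 : Tendsto (τ x hx) (𝓝[W ∩ B] y) (𝓝 (τ x hx y)) :=
      ((hτc x hx).continuousWithinAt hyV |>.continuousAt ((hVo x hx).mem_nhds hyV)).continuousWithinAt.tendsto
    have h2 : Tendsto (τ x' hx') (𝓝[W ∩ B] y) (𝓝 (τ x' hx' y)) :=
      ((hτc x' hx').continuousWithinAt hyV' |>.continuousAt ((hVo x' hx').mem_nhds hyV')).continuousWithinAt.tendsto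
    have h3 : τ x hx =ᶠ[𝓝[W ∩ B] y] τ x' hx' := by
      filter_upwards [self_mem_nhdsWithin] with z hz
      rw [hτσ x hx z ⟨hz.1.1, hz.2⟩, hτσ x' hx' z ⟨hz.1.2, hz.2⟩]
    exact tendsto_nhds_unique_of_eventuallyEq h1 h2 h3
  -- the glued section
  refine ⟨fun y => if h : y ∈ closure B then τ y h y else σ y, fun x₀ hx₀ => ?_, fun y hy => ?_, fun b hb => ?_⟩
  · -- continuity within the closure: near `x₀` the glued section is `τ x₀`
    have hev : (fun y => if h : y ∈ closure B then τ y h y else σ y) =ᶠ[𝓝[closure B] x₀] τ x₀ hx₀ := by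
      have hmem : closure B ∩ V x₀ hx₀ ∈ 𝓝[closure B] x₀ := inter_mem_nhdsWithin _ (hVn x₀ hx₀)
      filter_upwards [hmem] with y hy
      rw [dif_pos hy.1]
      exact hagree y hy.1 x₀ hx₀ y hy.1 (mem_of_mem_nhds (hVn y hy.1)) hy.2
    refine ContinuousWithinAt.congr_of_eventuallyEq ?_ hev ?_
    · exact ((hτc x₀ hx₀).continuousWithinAt (mem_of_mem_nhds (hVn x₀ hx₀)) |>.continuousAt (hVn x₀ hx₀)).continuousWithinAt
    · simp only [dif_pos hx₀]
  · simp only [dif_pos hy]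
    exact hpτ y hy y (mem_of_mem_nhds (hVn y hy))
  · have hb' : b ∈ closure B := subset_closure hb
    simp only [dif_pos hb']
    exact hτσ b hb' b ⟨mem_of_mem_nhds (hVn b hb'), hb⟩

/-! ### Lemme 6: extension over the whole base -/

/-- **Density of paths makes an open dense set locally arc-connected in the base** (the reduction
in Cerf's proof of Lemme 6). Let `𝒜` be locally path connected, `ℬ ⊆ 𝒜` open, and suppose every
path of `𝒜` is approximated, in the compact-open topology of `C([0, 1], 𝒜)`, by paths of `ℬ`.
Then for every `x` and every neighbourhood `𝒰` of `x` there is a neighbourhood `𝒱 ⊆ 𝒰` of `x`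
any two points of which lying in `ℬ` are joined by a path in `𝒰 ∩ ℬ`: join them in a
path-connected `𝒱 ⊆ 𝒰`, approximate by a path of `ℬ` inside `𝒰` with ends in small
path-connected neighbourhoods of the two points inside `𝒰 ∩ ℬ`, and concatenate.
[cite: CerfDiffeoSphere1968, Ch. I §4, Lemme 6] -/
theorem locallyJoined_of_dense_paths [LocallyPathConnectedSpace A] {B : Set A} (hBo : IsOpen B)
    (hdense : ∀ (γ : C(unitInterval, A)) (N : Set C(unitInterval, A)), N ∈ 𝓝 γ →
      ∃ γ' ∈ N, ∀ t, γ' t ∈ B)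
    (x : A) {U : Set A} (hU : U ∈ 𝓝 x) :
    ∃ V ∈ 𝓝 x, V ⊆ U ∧ ∀ b ∈ V ∩ B, ∀ b' ∈ V ∩ B, JoinedIn (U ∩ B) b b' := by
  -- shrink `U` to an open set, then to a path-connected neighbourhood `V`
  set U' : Set A := interior U with hU'
  have hU'o : IsOpen U' := isOpen_interior
  have hxU' : x ∈ U' := mem_interior_iff_mem_nhds.2 hU
  obtain ⟨V, ⟨hVn, hVpc⟩, hVU'⟩ := (path_connected_basis x).mem_iff.1 (hU'o.mem_nhds hxU')
  refine ⟨V, hVn, (hVU'.trans interior_subset), fun b hb b' hb' => ?_⟩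
  -- path-connected neighbourhoods of `b`, `b'` inside `U' ∩ B`
  obtain ⟨W₀, ⟨hW₀n, hW₀pc⟩, hW₀sub⟩ :=
    (path_connected_basis b).mem_iff.1 ((hU'o.inter hBo).mem_nhds ⟨hVU' hb.1, hb.2⟩)
  obtain ⟨W₁, ⟨hW₁n, hW₁pc⟩, hW₁sub⟩ :=
    (path_connected_basis b').mem_iff.1 ((hU'o.inter hBo).mem_nhds ⟨hVU' hb'.1, hb'.2⟩)
  -- a path from `b` to `b'` inside `V ⊆ U'`
  obtain ⟨γ, hγ⟩ : ∃ γ : Path b b', ∀ t, γ t ∈ U' := by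
    have hj := hVpc.joinedIn b hb.1 b' hb'.1
    exact ⟨hj.somePath, fun t => hVU' (hj.somePath_mem t)⟩
  -- the compact-open neighbourhood: inside `U'`, starting in `W₀°`, ending in `W₁°`
  set N : Set C(unitInterval, A) := {f | MapsTo f univ U'} ∩ ({f | MapsTo f {0} (interior W₀)} ∩
    {f | MapsTo f {1} (interior W₁)}) with hN
  have hNo : IsOpen N :=
    (ContinuousMap.isOpen_setOf_mapsTo isCompact_univ hU'o).inter
      ((ContinuousMap.isOpen_setOf_mapsTo isCompact_singleton isOpen_interior).inter
        (ContinuousMap.isOpen_setOf_mapsTo isCompact_singleton isOpen_interior))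
  have hγN : (γ : C(unitInterval, A)) ∈ N := by
    refine ⟨fun t _ => hγ t, fun t ht => ?_, fun t ht => ?_⟩
    · rw [mem_singleton_iff] at ht; subst ht
      show γ 0 ∈ interior W₀
      rw [γ.source]; exact mem_interior_iff_mem_nhds.2 hW₀n
    · rw [mem_singleton_iff] at ht; subst ht
      show γ 1 ∈ interior W₁
      rw [γ.target]; exact mem_interior_iff_mem_nhds.2 hW₁n
  obtain ⟨γ', hγ'N, hγ'B⟩ := hdense γ N (hNo.mem_nhds hγN)
  obtain ⟨hγ'U, hγ'0, hγ'1⟩ := hγ'N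
  have h0 : γ' 0 ∈ W₀ := interior_subset (hγ'0 (mem_singleton _))
  have h1 : γ' 1 ∈ W₁ := interior_subset (hγ'1 (mem_singleton _))
  -- concatenate: `b ⇝ γ' 0` in `W₀`, `γ' 0 ⇝ γ' 1` along `γ'`, `γ' 1 ⇝ b'` in `W₁`
  have hsub : U' ∩ B ⊆ U ∩ B := inter_subset_inter_left _ interior_subset
  have j0 : JoinedIn (U ∩ B) b (γ' 0) :=
    ((hW₀pc.joinedIn b (mem_of_mem_nhds hW₀n) _ h0).mono hW₀sub).mono hsub
  have j2 : JoinedIn (U ∩ B) (γ' 1) b' :=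
    ((hW₁pc.joinedIn _ h1 b' (mem_of_mem_nhds hW₁n)).mono hW₁sub).mono hsub
  have j1 : JoinedIn (U ∩ B) (γ' 0) (γ' 1) := by
    refine ⟨⟨γ', by simp, by simp⟩, fun t => hsub ⟨hγ'U (mem_univ t), hγ'B t⟩⟩
  exact (j0.trans j1).trans j2

/-- **Cerf's Lemme 6: over a locally path connected base, a continuous section of a covering over
an open dense `ℬ` extends to a global continuous section as soon as the paths of `ℬ` are dense
in the paths of the base** (compact-open topology; the total space Hausdorff). Reduction to
Lemme 5 through `locallyJoined_of_dense_paths`, the closure of `ℬ` being everything.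
[cite: CerfDiffeoSphere1968, Ch. I §4, Lemme 6] -/
theorem exists_section_extension_of_dense_paths [T2Space R] {p : R → A} (hp : IsCoveringMap p)
    [LocallyPathConnectedSpace A] {B : Set A} (hBo : IsOpen B) (hBd : Dense B)
    (hdense : ∀ (γ : C(unitInterval, A)) (N : Set C(unitInterval, A)), N ∈ 𝓝 γ →
      ∃ γ' ∈ N, ∀ t, γ' t ∈ B)
    {σ : A → R} (hσ : ContinuousOn σ B) (hpσ : ∀ b ∈ B, p (σ b) = b) :
    ∃ τ : A → R, Continuous τ ∧ (∀ y, p (τ y) = y) ∧ ∀ b ∈ B, τ b = σ b := by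
  have hB : ∀ x ∈ closure B, ∀ U ∈ 𝓝 x, ∃ V ∈ 𝓝 x, V ⊆ U ∧ ∀ b ∈ V ∩ B, ∀ b' ∈ V ∩ B, JoinedIn (U ∩ B) b b' :=
    fun x _ U hU => locallyJoined_of_dense_paths hBo hdense x hU
  obtain ⟨τ, hτc, hpτ, hτσ⟩ := exists_section_extension_closure hp hB hσ hpσ
  rw [hBd.closure_eq] at hτc hpτ
  exact ⟨τ, continuousOn_univ.1 hτc, fun y => hpτ y (mem_univ y), hτσ⟩

end Literature.Topology.CoveringSpaces
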